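import Summits.CriticalPhenomena.PercolationContinuityZ3.Theorems.PercShatteringRaceNearLinearTwoClusterDecayOfTICM
import Summits.CriticalPhenomena.PercolationContinuityZ3.Theorems.PercShatteringRaceNearLinearTwoClusterDecayStubExplorationBound

/-!
# `NearLinearTwoClusterDecay` (stmt-CriticalPhenomena-5785) from `TICM` ALONE — the line
# `first-cluster-exploration-independent-crossings-meet` closed modulo its single open stub

Route `PercShatteringRace`, crux `U(1/6)`. The lead skeleton (rev L2,
`Cruxes/NearLinearTwoClusterDecay/Lines/first_cluster_exploration_independent_crossings_meet.lean`) has two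
registered stubs: A = `stub_explorationBound` (first-crossing-cluster exploration bound, LANDED as the tree
theorem `stub_explorationBound`, `…StubExplorationBound.lean`, p97134) and B = `stub_independentCrossingsMeet`
= `∃ M ≥ 2, TICM_M` (two independent critical crossings of a long shell meet; OPEN — the entire `d = 3`
content). This file discharges hypothesis A of the compositions of `…OfTICM.lean` (p96786) with the landed
theorem, leaving stub B as the ONLY hypothesis:

* `shellNonCertainty_of_ticm` — `TICM ⇒ NP` (clean bounded-aspect shell non-certainty, the promoted atom of
  line `critical-orange-peeling`);
* `nearLinearTwoClusterDecay_of_ticm` — **stub B alone ⇒ the crux BY NAME**;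
* `critBoxTwoArmsDecay_of_ticm` — stub B alone ⇒ `PercFiniteBoxLRO.CritBoxTwoArmsDecay` (stmt-0859);
* `nearLinearTwoClusterDecay_of_sparseTicm` — the polylog-sparse form of B suffices.

Certified edges now in the tree for this crux: `CritAnnulusNonCrossing (0846) ⇒ TICM_3`
(`ticm_of_critAnnulusNonCrossing`) `⇒ NP_3` (`shellNonCertainty_of_ticm`) `⇒ U(b) ∀ b > 0 ⊇ U(1/6)`.
-/

noncomputable section

open MeasureTheory Filter
open scoped Topology ENNReal
open Literature.Probability.Percolation Literature.Probability.LatticeModels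

/-! ## `TICM` alone ⇒ the crux (stub A = the landed `stub_explorationBound`)

The exploration bound (stub A) is now the tree's theorem `stub_explorationBound`
(`Theorems/PercShatteringRaceNearLinearTwoClusterDecayStubExplorationBound.lean`, worker wave 1 of lead 1),
so the only remaining hypothesis is stub B = `∃ M ≥ 2, TICM_M` (OPEN: two independent critical crossings
of a long shell meet).
-/

namespace Summit.CriticalPhenomena.PercolationContinuityZ3.Theorems

/-- **`TICM ⇒ NP`** (clean forms): for some `M ≥ 2`, bounded-aspect shell two-cluster non-certainty at
`p_c`, from stub B alone (stub A = `stub_explorationBound`, landed). -/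
theorem shellNonCertainty_of_ticm
    (hT : ∃ M : ℕ, 2 ≤ M ∧ ∃ c : ℝ, 0 < c ∧ ∀ᶠ N : ℕ in atTop,
      ∫⁻ ω, bondPercolation (zdGraph 3) (criticalProbI 3)
          {ω' : BondConfig (Site 3) |
            ∃ u ∈ (↑(box 3 (N + 1)) : Set (Site 3)) \ ↑(box 3 N),
            ∃ v ∈ innerBoundary (zdGraph 3) (box 3 (M * N)),
              ω ∈ openConnIn ((↑(box 3 (M * N)) : Set (Site 3)) \ ↑(box 3 N)) u v ∧
              ∃ u' ∈ (↑(box 3 (N + 1)) : Set (Site 3)) \ ↑(box 3 N),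
              ∃ v' ∈ innerBoundary (zdGraph 3) (box 3 (M * N)),
                ω' ∈ openConnIn ((((↑(box 3 (M * N)) : Set (Site 3)) \ ↑(box 3 N))) ∩
                  {w : Site 3 | ω ∉ openConnIn ((↑(box 3 (M * N)) : Set (Site 3)) \ ↑(box 3 N)) u w})
                  u' v'}
        ∂(bondPercolation (zdGraph 3) (criticalProbI 3)) ≤ ENNReal.ofReal (1 - c)) :
    ∃ M : ℕ, 2 ≤ M ∧ ∃ ε : ℝ, 0 < ε ∧ ∀ᶠ N : ℕ in atTop,
      (bondPercolation (zdGraph 3) (criticalProbI 3)).real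
          {ω | ∃ u ∈ (↑(box 3 (N + 1)) : Set (Site 3)) \ ↑(box 3 N),
            ∃ u' ∈ (↑(box 3 (N + 1)) : Set (Site 3)) \ ↑(box 3 N),
            ∃ v ∈ innerBoundary (zdGraph 3) (box 3 (M * N)),
            ∃ v' ∈ innerBoundary (zdGraph 3) (box 3 (M * N)),
              ω ∈ openConnIn ((↑(box 3 (M * N)) : Set (Site 3)) \ ↑(box 3 N)) u v ∧
              ω ∈ openConnIn ((↑(box 3 (M * N)) : Set (Site 3)) \ ↑(box 3 N)) u' v' ∧
              ω ∉ openConnIn ((↑(box 3 (M * N)) : Set (Site 3)) \ ↑(box 3 N)) u u'}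
        ≤ 1 - ε :=
  shellNonCertainty_of_explorationBound_of_ticm (fun N R => stub_explorationBound (criticalProbI 3) N R) hT

/-- **Stub B (`∃ M ≥ 2, TICM_M`) ALONE ⇒ the crux `NearLinearTwoClusterDecay` BY NAME**: the line
`first-cluster-exploration-independent-crossings-meet` closed modulo its single open stub. -/
theorem nearLinearTwoClusterDecay_of_ticm
    (hT : ∃ M : ℕ, 2 ≤ M ∧ ∃ c : ℝ, 0 < c ∧ ∀ᶠ N : ℕ in atTop,
      ∫⁻ ω, bondPercolation (zdGraph 3) (criticalProbI 3)
          {ω' : BondConfig (Site 3) |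
            ∃ u ∈ (↑(box 3 (N + 1)) : Set (Site 3)) \ ↑(box 3 N),
            ∃ v ∈ innerBoundary (zdGraph 3) (box 3 (M * N)),
              ω ∈ openConnIn ((↑(box 3 (M * N)) : Set (Site 3)) \ ↑(box 3 N)) u v ∧
              ∃ u' ∈ (↑(box 3 (N + 1)) : Set (Site 3)) \ ↑(box 3 N),
              ∃ v' ∈ innerBoundary (zdGraph 3) (box 3 (M * N)),
                ω' ∈ openConnIn ((((↑(box 3 (M * N)) : Set (Site 3)) \ ↑(box 3 N))) ∩
                  {w : Site 3 | ω ∉ openConnIn ((↑(box 3 (M * N)) : Set (Site 3)) \ ↑(box 3 N)) u w})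
                  u' v'}
        ∂(bondPercolation (zdGraph 3) (criticalProbI 3)) ≤ ENNReal.ofReal (1 - c)) :
    Summit.CriticalPhenomena.PercolationContinuityZ3.Theses.PercShatteringRace.NearLinearTwoClusterDecay :=
  nearLinearTwoClusterDecay_of_explorationBound_of_ticm
    (fun N R => stub_explorationBound (criticalProbI 3) N R) hT

/-- **Stub B ALONE ⇒ `PercFiniteBoxLRO.CritBoxTwoArmsDecay`** (stmt-CriticalPhenomena-0859). -/
theorem critBoxTwoArmsDecay_of_ticm
    (hT : ∃ M : ℕ, 2 ≤ M ∧ ∃ c : ℝ, 0 < c ∧ ∀ᶠ N : ℕ in atTop,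
      ∫⁻ ω, bondPercolation (zdGraph 3) (criticalProbI 3)
          {ω' : BondConfig (Site 3) |
            ∃ u ∈ (↑(box 3 (N + 1)) : Set (Site 3)) \ ↑(box 3 N),
            ∃ v ∈ innerBoundary (zdGraph 3) (box 3 (M * N)),
              ω ∈ openConnIn ((↑(box 3 (M * N)) : Set (Site 3)) \ ↑(box 3 N)) u v ∧
              ∃ u' ∈ (↑(box 3 (N + 1)) : Set (Site 3)) \ ↑(box 3 N),
              ∃ v' ∈ innerBoundary (zdGraph 3) (box 3 (M * N)),
                ω' ∈ openConnIn ((((↑(box 3 (M * N)) : Set (Site 3)) \ ↑(box 3 N))) ∩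
                  {w : Site 3 | ω ∉ openConnIn ((↑(box 3 (M * N)) : Set (Site 3)) \ ↑(box 3 N)) u w})
                  u' v'}
        ∂(bondPercolation (zdGraph 3) (criticalProbI 3)) ≤ ENNReal.ofReal (1 - c)) :
    Summit.CriticalPhenomena.PercolationContinuityZ3.Theses.PercFiniteBoxLRO.CritBoxTwoArmsDecay :=
  critBoxTwoArmsDecay_of_explorationBound_of_ticm
    (fun N R => stub_explorationBound (criticalProbI 3) N R) hT

/-- **Polylog-sparse `TICM` ALONE ⇒ the crux** (the weakest form of stub B the landed chain can use). -/
theorem nearLinearTwoClusterDecay_of_sparseTicm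
    (hT : ∃ M : ℕ, 2 ≤ M ∧ ∃ σ : ℝ, 0 ≤ σ ∧ σ < 1 ∧ ∃ c : ℝ, 0 < c ∧ ∃ L : ℕ,
      ∀ᶠ N : ℕ in atTop, ∃ ℓ < L,
      ∫⁻ ω, bondPercolation (zdGraph 3) (criticalProbI 3)
          {ω' : BondConfig (Site 3) |
            ∃ u ∈ (↑(box 3 (M ^ ℓ * N + 1)) : Set (Site 3)) \ ↑(box 3 (M ^ ℓ * N)),
            ∃ v ∈ innerBoundary (zdGraph 3) (box 3 (M ^ (ℓ + 1) * N)),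
              ω ∈ openConnIn ((↑(box 3 (M ^ (ℓ + 1) * N)) : Set (Site 3)) \ ↑(box 3 (M ^ ℓ * N))) u v ∧
              ∃ u' ∈ (↑(box 3 (M ^ ℓ * N + 1)) : Set (Site 3)) \ ↑(box 3 (M ^ ℓ * N)),
              ∃ v' ∈ innerBoundary (zdGraph 3) (box 3 (M ^ (ℓ + 1) * N)),
                ω' ∈ openConnIn ((((↑(box 3 (M ^ (ℓ + 1) * N)) : Set (Site 3)) \ ↑(box 3 (M ^ ℓ * N)))) ∩
                  {w : Site 3 | ω ∉ openConnIn ((↑(box 3 (M ^ (ℓ + 1) * N)) : Set (Site 3)) \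
                    ↑(box 3 (M ^ ℓ * N))) u w}) u' v'}
        ∂(bondPercolation (zdGraph 3) (criticalProbI 3)) ≤ ENNReal.ofReal (1 - c / Real.log N ^ σ)) :
    Summit.CriticalPhenomena.PercolationContinuityZ3.Theses.PercShatteringRace.NearLinearTwoClusterDecay :=
  nearLinearTwoClusterDecay_of_explorationBound_of_sparseTicm
    (fun N R => stub_explorationBound (criticalProbI 3) N R) hT

end Summit.CriticalPhenomena.PercolationContinuityZ3.Theorems

end
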